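import Summits.QuantumFields.YangMills.Theorems.UnitScaleTiltHalvingP1FlatCoreTopRowsLocal
import Summits.QuantumFields.YangMills.Theorems.UnitScaleTiltHalvingP1FlatCoreFrameLinTrace
import Summits.QuantumFields.YangMills.Theorems.UnitScaleTiltHalvingP1FlatCoreFrameLinStar
import HarnessLib

/-!
# Line H (`BirthV10.stub_halvingStep`, stmt-QuantumFields-19200), J4c **(T4b)∕(τ-3) FILE 3c: THE TRACE ROW OF THE TOP MEMBER FROM THE LOCAL TOWER** — the
# hypothesis `hTopTrace` of the τ-twin `P1FlatCoreTopStepTorus.hFP_kLevel_top_RD_traceFree` (★w8-19936 g3, (τ-3)) DISCHARGED from the LOCAL trace row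
# ✓`P1FlatCoreFrameLinTrace.Cnl_trace_zero_local` (row (τ-1)) through the site family of ✓`P1FlatCoreTopRowsLocal` §1

Cell `ym3-torus` (HUMAN RULING D-0037: YM₃ on T³ is ladder rung R3, NOT the Clay problem), width seat `ym-ust-19936-w3` (gen 7).
`--supports stmt-QuantumFields-19200 --as helper`; THEOREMS ONLY (0 `def`, 0 `sorry`); count-neutral; nothing here claims `core′`, the stub, the crux or the gap.

WHAT.  ★★ `topTrace_of_local` — the `hTopTrace` text at a top label `yc`: `τ(C(l₀)) = 0` for the top nonlinear part
`C(m) := log κf(m)_k(π_k yc) − (Q′_k m)(π_k yc)` of a `τ`-free bottom datum `l₀` (`τ(l₀ s) = 0`), for every continuous tracial `τ` on the C⋆-algebra `𝔹`,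
from ✓`P1FlatCoreFrameLinTrace.Cnl_trace_zero_local` on the family `S^{yc} j := {π_j z | ⌊z ∕ L^{k−j}⌋ = yc}` of ✓`P1FlatCoreTopRowsLocal` §1
(`emb_mem_family`, `stairEnd_mem_family`, `coverAt_mem_family`), its disc conditions (radius `1/24`) discharged by the size row `‖log κ_j‖ ≤ α₄ + ω`
(✓`P1FlatCoreFrameLinStar.exp_mlog_and_norm_mlog_effGauge_le_local`, fed by `sup_on_family`∕`osc_on_family`) and ✓`P1FlatCoreFrameLinTrace.norm_stairRel_sub_one_le_24th`∕
`norm_exp_sub_one_le_24th` under the SINGLE window `160(α₄ + δ + 5ω) ≤ ¼` (`ω := d·L·α₄∕2`; it gives `2δ + 4(α₄ + ω) ≤ 1∕160`).  Letters = ✓`topReal_of_local`'s with the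
unitarity row `hWu` replaced by the stair trace row `hWτ : τ(log W(Γ)) = 0` (at the door's `M₂(ℂ)`, `τ := tr`, both follow from SU(2)-valued stairs — lit
✓`BlockAveragingExpMeanLog.trace_mlog_eq_zero_of_det_eq_one`).  Same namespace as ✓`…TopRowsLocal`∕✓`…TopRowsReal`, so the name is `P1FlatCoreTopRowsLocal.topTrace_of_local`.
HONEST SCOPE.  Bookkeeping; the analysis is the tower induction of ✓`…FrameLinTrace` (lit ✓`B8TraceLogProduct`).  Nothing of [Balaban1985RegularSpaces] Prop. 5 ∕ Sect. E is proved here.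

References: T. Bałaban, CMP **99** (1985) 75–102 [Balaban1985RegularSpaces] ((1.17) p.78, Sect. E (1.111), (1.116), (1.120)–(1.121) pp.95–96); CMP **98** (1985) 17–51
[Balaban1985Averaging] ((28)–(33) pp.22–23, (97)–(100) p.32, (110) p.34).
-/

set_option autoImplicit false

noncomputable section

open scoped BigOperators
open NormedSpace

namespace Summit.QuantumFields.YangMills.Theorems.P1FlatCoreTopRowsLocal

open Literature.MathematicalPhysics.QuantumFieldTheory.Balaban1983to89
open T4Continuum BlockAveraging ExpMeanLog MatrixLog
open B10Eq27TorusAxialLog (holT gaugeActT)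
open LatticeFieldCalculus (siteAvgIter)
open B15Eq112TorusCover (cover)
open B14DomainGeom (Pt)
open Node00 (coverAt coverAt_zero emb_coverAt blockMap_blockMap)
open Literature.MathematicalPhysics.QuantumLattice (blockMap blockBase blockSites mem_blockSites_iff blockMap_blockBase_add_of_lt)
open B7Prop1Explicit (e l1)
open B7Prop1Local (InBox)
open B8Ineq130 (tlo thi)
open BlockAveragingEMLLinearised (walkEnd_emb_stairWord_eq_blockSite)
open Summit.QuantumFields.YangMills.Theorems.Prop8ChartDoubleBar (vframeU dbarIterU)

variable {P : Params}


/-! ## §6 (v1.3) The trace row of the top member, from the LOCAL trace row ✓`P1FlatCoreFrameLinTrace.Cnl_trace_zero_local` -/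

section RowsTrace

open Summit.QuantumFields.YangMills.Theorems.P1FlatCoreFrameLinTrace (Cnl_trace_zero_local norm_stairRel_sub_one_le_24th
  norm_exp_sub_one_le_24th)
open Summit.QuantumFields.YangMills.Theorems.P1FlatCoreFrameLinStar (exp_mlog_and_norm_mlog_effGauge_le_local)

/-- ★★ **THE TRACE ROW OF THE TOP MEMBER FROM THE LOCAL TOWER** — the `hTopTrace` text of the τ-twin `hFP_kLevel_top_RD_traceFree` at a top label `yc`:
`τ(C(l₀)) = 0` for the top nonlinear part `C(m) := log κf(m)_k(π_k yc) − (Q′_k m)(π_k yc)` of a `τ`-free datum `l₀`, from ✓`P1FlatCoreFrameLinTrace.Cnl_trace_zero_local`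
(C⋆-algebra, continuous tracial `τ`, stairs `τ`-free in the logarithm `hWτ`), its disc conditions discharged by the size row `‖log κ_j‖ ≤ α₄ + ω`
(✓`P1FlatCoreFrameLinStar.exp_mlog_and_norm_mlog_effGauge_le_local`) and ✓`norm_stairRel_sub_one_le_24th`∕`norm_exp_sub_one_le_24th` under the window
`160(α₄ + δ + 5ω) ≤ ¼`. [cite: Balaban1985RegularSpaces, (1.17) p.78, Sect. E (1.111), (1.116) pp.95-96; Balaban1985Averaging, (28)-(33) pp.22-23] -/
theorem topTrace_of_local {𝔹 : Type*} [CStarAlgebra 𝔹] [Nonempty (Idx P)] {k : ℕ} (hk : k ≤ P.m + P.K) (W : GaugeField P 0 𝔹ˣ)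
    (κf : (Site P 0 → 𝔹) → (i : ℕ) → GaugeTransf P i 𝔹ˣ)
    (hs : ∀ (m : Site P 0 → 𝔹) (i : ℕ) (y : Site P (i + 1)),
      κf m (i + 1) y = (vframeU (gaugeActT (κf m i) (dbarIterU i W)) y)⁻¹ * κf m i (emb y) * vframeU (dbarIterU i W) y)
    (h0 : ∀ (m : Site P 0 → 𝔹) (x : Site P 0), ((κf m 0 x : 𝔹ˣ) : 𝔹) = exp (m x))
    {α₄ δ : ℝ} (hα₄ : 0 ≤ α₄) (hδ : 0 ≤ δ) (yc : Pt P.d)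
    (hH : ∀ j < k, ∀ z : Pt P.d, blockMap (P.L ^ (k - (j + 1))) z = yc → ∀ idx : Idx P,
      ‖((holT (dbarIterU j W) (emb (coverAt P (j + 1) z)) (stairWord idx.2.1 (off idx.1)) : 𝔹ˣ) : 𝔹) - 1‖ ≤ δ)
    (τ : 𝔹 →L[ℂ] ℂ) (hτ : ∀ x y : 𝔹, τ (x * y) = τ (y * x))
    (hWτ : ∀ j < k, ∀ z : Pt P.d, blockMap (P.L ^ (k - (j + 1))) z = yc → ∀ idx : Idx P,
      τ (mlog ((holT (dbarIterU j W) (emb (coverAt P (j + 1) z)) (stairWord idx.2.1 (off idx.1)) : 𝔹ˣ) : 𝔹)) = 0)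
    (hr : 160 * (α₄ + δ + 5 * ((P.d : ℝ) * P.L * α₄ / 2)) ≤ 1 / 4)
    (l₀ : Site P 0 → 𝔹) (hl₀τ : ∀ s, τ (l₀ s) = 0)
    (hb : ∀ x : Pt P.d, InBox (tlo P.L yc k) (thi P.L yc k) x → ‖l₀ (cover P x)‖ ≤ α₄)
    (hg : ∀ (x : Pt P.d) (ν : Fin P.d), InBox (tlo P.L yc k) (thi P.L yc k) x → InBox (tlo P.L yc k) (thi P.L yc k) (x + e ν) →
      ‖l₀ (cover P (x + e ν)) - l₀ (cover P x)‖ ≤ α₄ * ((P.L : ℝ) ^ k)⁻¹) :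
    τ (mlog ((κf l₀ k (coverAt P k yc) : 𝔹ˣ) : 𝔹) - siteAvgIter k l₀ (coverAt P k yc)) = 0 := by
  set ω : ℝ := (P.d : ℝ) * P.L * α₄ / 2 with hω
  have hω0 : 0 ≤ ω := by positivity
  -- the windows: everything follows from `160(α₄ + δ + 5ω) ≤ ¼`
  have hsum : α₄ + δ + 5 * ω ≤ 1 / 640 := by linarith
  have hw : 2 * δ + 4 * (α₄ + ω) ≤ 1 / 50 := by linarith
  have hδ2 : δ ≤ 1 / 2 := by linarith
  have haω : α₄ + ω ≤ 1 / 50 := by linarith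
  let S : (j : ℕ) → Set (Site P j) := fun j => {w | ∃ z : Pt P.d, blockMap (P.L ^ (k - j)) z = yc ∧ w = coverAt P j z}
  have hSe : ∀ j < k, ∀ y ∈ S (j + 1), emb y ∈ S j := fun j hj y hy => by
    obtain ⟨z, hz, rfl⟩ := hy; obtain ⟨w, hw, he⟩ := emb_mem_family hj hk yc z hz; exact ⟨w, hw, he⟩
  have hSs : ∀ j < k, ∀ y ∈ S (j + 1), ∀ idx : Idx P, walkEnd (emb y) (stairWord idx.2.1 (off idx.1)) ∈ S j := fun j hj y hy idx => by
    obtain ⟨z, hz, rfl⟩ := hy; obtain ⟨w, hw, he⟩ := stairEnd_mem_family hj hk yc z hz idx; exact ⟨w, hw, he⟩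
  have hH' : ∀ j < k, ∀ y ∈ S (j + 1), ∀ idx : Idx P,
      ‖((holT (dbarIterU j W) (emb y) (stairWord idx.2.1 (off idx.1)) : 𝔹ˣ) : 𝔹) - 1‖ ≤ δ := by
    rintro j hj y ⟨z, hz, rfl⟩ idx; exact hH j hj z hz idx
  have hWτ' : ∀ j < k, ∀ y ∈ S (j + 1), ∀ idx : Idx P,
      τ (mlog ((holT (dbarIterU j W) (emb y) (stairWord idx.2.1 (off idx.1)) : 𝔹ˣ) : 𝔹)) = 0 := by
    rintro j hj y ⟨z, hz, rfl⟩ idx; exact hWτ j hj z hz idx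
  have hWs : ∀ j < k, ∀ y ∈ S (j + 1), ∀ idx : Idx P,
      ‖((holT (dbarIterU j W) (emb y) (stairWord idx.2.1 (off idx.1)) : 𝔹ˣ) : 𝔹) - 1‖ ≤ 1 / 24 :=
    fun j hj y hy idx => (hH' j hj y hy idx).trans (by linarith)
  have hyc : coverAt P k yc ∈ S k := coverAt_mem_family k yc
  -- the bottom datum is small on the family
  have hμs : ∀ x ∈ S 0, ‖l₀ x‖ < Real.log 2 := fun x hx =>
    (sup_on_family yc l₀ hb x hx).trans_lt (by linarith [Real.log_two_gt_d9])
  -- the size row `‖log κ_j‖ ≤ α₄ + ω` on the family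
  have hsize := exp_mlog_and_norm_mlog_effGauge_le_local W (κf l₀) (hs l₀) l₀ (h0 l₀) hα₄ hδ hω0 k S hSe hSs
    (sup_on_family yc l₀ hb) hH' (osc_on_family hk yc l₀ hα₄ hg) hr
  -- disc conditions at radius `1/24`
  have hκ : ∀ i < k, ∀ x ∈ S i, ‖((κf l₀ i x : 𝔹ˣ) : 𝔹) - 1‖ ≤ 1 / 24 := by
    intro i hi x hx
    have h := hsize i hi.le x hx
    rw [← h.1]
    exact norm_exp_sub_one_le_24th _ (h.2.trans haω)
  have hdisc : ∀ i < k, ∀ y ∈ S (i + 1), ∀ idx : Idx P,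
      ‖((holT (dbarIterU i W) (emb y) (stairWord idx.2.1 (off idx.1)) *
          ((κf l₀ i (walkEnd (emb y) (stairWord idx.2.1 (off idx.1))))⁻¹ * κf l₀ i (emb y)) : 𝔹ˣ) : 𝔹) - 1‖ ≤ 1 / 24 := by
    intro i hi y hy idx
    have hx := hsize i hi.le _ (hSs i hi y hy idx)
    have hz := hsize i hi.le _ (hSe i hi y hy)
    exact norm_stairRel_sub_one_le_24th _ (κf l₀ i) (fun w => mlog ((κf l₀ i w : 𝔹ˣ) : 𝔹)) _ _ hx.1.symm hz.1.symm (hH' i hi y hy idx)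
      hx.2 hz.2 hδ2 hw
  exact Cnl_trace_zero_local W κf hs h0 l₀ k S hSe hSs τ hτ hl₀τ hμs hWτ' hWs hκ hdisc (coverAt P k yc) hyc

end RowsTrace

end Summit.QuantumFields.YangMills.Theorems.P1FlatCoreTopRowsLocal

end
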